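import Summits.QuantumFields.YangMills.Theorems.UnitScaleTiltProp7Size19Orders01T3
import HarnessLib

/-!
# Route `UnitScaleTilt`, crux «MinimiserStabilityRegPr» (stmt-QuantumFields-19200, stub EX `stub_existenceMinimalOrbit`), route (α), node N06(d = 3) —
# **JUNCTION-SIZE19: THE DISPLAYED ROW `hSize19′` OF THE EX KNIT OF RECORD (v3.4ˢ″ ✓`Prop7StubEXOfChartPiecesTwS7`, ★★OWNER RULING g27-№10 (2)) AT ONE MEMBER FROM THREE
# PRINT-SHAPED ROWS** — (46)₁∕(46)₂ for the named (45)–(46) letter `H` (first and second order: [Balaban1985Variational] (46) p.285, (137)–(140) pp.298–299) and (136)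
# for the solution piece `ι(A₁) + ι(H₁B̃)` (p.298) — the rest being LANDED: orders 0, 1 ✓`Prop7Size19Orders01.orders01_of_eq111_T3` (★px18 g0, p654309: Prop. 6's a-priori
# size of the solution of (111), (103) + (20), (55)), the intro rule ✓`Prop7NMax19Algebra.nMax19_le_iff` and the linearity of the (19)-members (★px14 g0, p650298).
#
# Cell `ym3-torus`, width seat `ym-ust-19200-w2` (gen 5; EX knit lineage ∕ EX letter namer).  THEOREMS ONLY (0 `def`, 0 `sorry`); `--supports stmt-QuantumFields-19200 --as helper`,
# count-neutral.  YM₃ on T³ is a ladder rung (R3), not the Clay problem; nothing here claims the stub, the crux, d = 4 or the mass gap.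
#
# THE PRINT (p. 299, (ii)): «|A′₁|, |∇_{U₀}A′₁|, |Δ_{U₀}A′₁|, |D*_{U₀}D_{U₀}A′₁| < ε₂ with ε₂ = O(1)C₁B₃ε₁».  The knit's chart exponent is `X = −i·(A′ − H·D(A′))`,
# `A′ = ηi·(ιA₁ + ι(H₁B̃))` ((47) of [Balaban1985Variational] in the chart of record), so `X = η·(ιA₁ + ι(H₁B̃)) + i·H(D(A′))`; its four (19)-members are bounded by:
# orders 0, 1 — ✓p654309; order 2 of the first piece — the displayed row `hΔsol` ((136) + the `D*D` twin (140) for the solution piece, in print's ε₁-form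
# `≤ MΔ·(L³·3L·ε₁)·η²` at the (115)-level field, one power of `η` below the chart exponent); order 2 of the second piece — the displayed row `h46₂` ((137)–(140):
# `‖D¹*D¹(HY)‖, ‖Δ¹(HY)‖ ≤ BH₂·η³·‖Y‖`, ★px5 g0's ✓p652273 `hΔH_of_rows` shape at `H := H46`) at `Y := D(A′)`, `‖D(A′)‖ ≤ 4C₂‖A′‖²` ((55) ✓`B11Prop3Model.Dfix_spec`).
#
# WHAT IS PROVED.  ★★★ **`size19_of_rows`** — at one member `(F, n, K)`, for generic letters `𝒢 W H₁ H Ct` with the displayed rows `norm_G quad norm_H₁ h46₀ h46₁ h46₂`, the chart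
# (47) as a quadratic-analytic map `hC` with the contraction windows `hq hR hεb`, Prop. 6's windows `h1 h2 h3`, `hSize19′`'s own guards `hreg hclose hwin`, the displayed
# solution `A₁` of (111) (`hA₁ heq`) and the row `hΔsol` for ITS (115)-piece: `nMax19 U₀ X ≤ M·(L³·3L·ε₁)` with
# `M = 11B₀ + 4·BH·C₂·η²·(11B₀)²·ρ + MΔ + 100·BH₂·C₂·B₀²·η²·ρ`, `ρ = L³·3L·ε₁` — the member text of the knit's `hSize19′` (its `Hf L i U₀ ↦ H`, `CmapTwS … U₀ ↦ Ct`,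
# `C₂ˢ ↦ C₂`).  INHABITABILITY (★★OWNER RULING g27-№9 (3)): `h46₀ h46₁ h46₂` — at `H := H46 … U₀` these are KH1 ✓p645309, ✓p649358 `…H46GradRowT3` and ✓p652273 `hΔH_of_rows`
# (modulo their displayed N06 rows); `hΔsol` — print's (128)–(136) for the solution of (111) (★px16 g0's ✓p654324 `…HDsolOfRowsT3` reduces it to (133) + named bounds; the
# T³ identity (133) for the (111)-letters is the open L piece); `hC hq hR hεb` — ✓`Prop7CmapTwSymInputs.inputs_CmapTwS` + the knit's `hq47 hR6 hrε2` after arithmetic.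
#
# References: T. Bałaban, CMP 102 (1985) 277–309 [Balaban1985Variational] ((19) p.281, (46)–(47) p.285, (55) p.286, (111) p.294, Prop. 6 p.295, (ii) + (123)–(140)
# pp.296–299); CMP 99 (1985) 389–434 [Balaban1985BackgroundPropagators] (Thm 3.12, (3.133)).
-/

noncomputable section

open scoped Matrix.Norms.L2Operator BigOperators

namespace Summit.QuantumFields.YangMills.Theorems.Prop7Size19OfRows

open Literature.MathematicalPhysics.QuantumFieldTheory.Balaban1983to89
open Literature.MathematicalPhysics.QuantumFieldTheory.Balaban1983to89.T3ContinuumYM3Torus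
open Literature.MathematicalPhysics.QuantumFieldTheory.Balaban1983to89.T3PrintedRegularMinimiser (RegPr)
open Literature.MathematicalPhysics.QuantumFieldTheory.Balaban1983to89.T3UnitLawDensityEML (ℰp)
open Literature.MathematicalPhysics.QuantumFieldTheory.Balaban1983to89.T3TiltDescent (descendTo)
open T3SectALandauChart (eta eta_pos bgUnits covGradT covCodiffCurlT covLapFormT CloseAvg)
open B9SectCLatticeCarrier (Bond)
open B11Eq115Space (NegSize NegSup Space115 JetSup)
open B11Eq111FrakG (nabla115)
open B11Eq98CurrentSlot (Jcur)
open B11Prop3Model (Dfix Dfix_spec)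
open B13Contraction113 (QuadAnalytic)
open MatrixLog (mlog)
open Summit.QuantumFields.YangMills.Theorems.Prop7TPrint (nMax19)
open Summit.QuantumFields.YangMills.Theorems.Prop7SectET3Transport (periodsT3 bondEquiv bgOfCfg)
open Summit.QuantumFields.YangMills.Theorems.Prop7SectET3Objects (prop6_bgOfCfg)
open Summit.QuantumFields.YangMills.Theorems.Prop7Bound20SymLog (bound20_symLog_of_closeAvg)
open Summit.QuantumFields.YangMills.Theorems.Prop7NMax19Algebra (nMax19_le_iff covCodiffCurlT_sub covCodiffCurlT_smul_complex covLapFormT_sub covLapFormT_smul_complex)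
open Summit.QuantumFields.YangMills.Theorems.Prop7H46GradRow (orders01_of_eta_smul_iota)
open Summit.QuantumFields.YangMills.Theorems.Prop7Size19Orders01 (iota_add orders01_of_eq111_T3)

variable (F : T3Family) (n K : ℕ) [Fact (0 < (F.L : ℝ))] [Fact (0 < ((F.L : ℝ)⁻¹) ^ (K - n))]

set_option maxHeartbeats 400000 in
/-- ★★★ **`hSize19′` AT ONE MEMBER FROM (46)₀₋₂ FOR THE NAMED LETTER `H` AND (136) FOR THE SOLUTION PIECE** (module docstring): `nMax19 U₀ X ≤ M·(L³·3L·ε₁)` for the knit's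
chart exponent `X = −i·(A′ − H·D(A′))`, `A′ = ηi·(ιA₁ + ι(H₁B̃))`, with `M = 11B₀ + 4·BH·C₂·η²·(11B₀)²·ρ + MΔ + 100·BH₂·C₂·B₀²·η²·ρ` (`ρ = L³·3L·ε₁`).
[cite: Balaban1985Variational, (ii) p.299, (19) p.281, (46)-(47) p.285, (55) p.286, (136)-(140) pp.298-299, Prop. 6 p.295; Balaban1985BackgroundPropagators, Thm 3.12 p.421] -/
theorem size19_of_rows (h : n ≤ K) (U₀ : GaugeField (F.P K) 0 (Matrix.specialUnitaryGroup (Fin 2) ℂ))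
    (V : GaugeField (F.P n) 0 (Matrix.specialUnitaryGroup (Fin 2) ℂ))
    (𝒢 : NegSize (F.L : ℝ) (((F.L : ℝ)⁻¹) ^ (K - n)) (fun _ : Bond 3 (periodsT3 F K) => K - n) 3 (Matrix (Fin 2) (Fin 2) ℂ) →L[ℂ]
          Space115 (F.L : ℝ) (((F.L : ℝ)⁻¹) ^ (K - n)) (fun _ : Bond 3 (periodsT3 F K) => K - n) (fun _ : Bond 3 (periodsT3 F K) × Fin 3 => K - n)
            (nabla115 (((F.L : ℝ)⁻¹) ^ (K - n)) (bgOfCfg F K U₀)))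
    (W : Space115 (F.L : ℝ) (((F.L : ℝ)⁻¹) ^ (K - n)) (fun _ : Bond 3 (periodsT3 F K) => K - n) (fun _ : Bond 3 (periodsT3 F K) × Fin 3 => K - n)
            (nabla115 (((F.L : ℝ)⁻¹) ^ (K - n)) (bgOfCfg F K U₀)) →
          NegSize (F.L : ℝ) (((F.L : ℝ)⁻¹) ^ (K - n)) (fun _ : Bond 3 (periodsT3 F K) => K - n) 3 (Matrix (Fin 2) (Fin 2) ℂ))
    (H₁ : (PBond (F.P n) 0 → Matrix (Fin 2) (Fin 2) ℂ) →L[ℂ]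
          Space115 (F.L : ℝ) (((F.L : ℝ)⁻¹) ^ (K - n)) (fun _ : Bond 3 (periodsT3 F K) => K - n) (fun _ : Bond 3 (periodsT3 F K) × Fin 3 => K - n)
            (nabla115 (((F.L : ℝ)⁻¹) ^ (K - n)) (bgOfCfg F K U₀)))
    (H : (PBond (F.P n) 0 → Matrix (Fin 2) (Fin 2) ℂ) →ₗ[ℂ] (PBond (F.P K) 0 → Matrix (Fin 2) (Fin 2) ℂ))
    (Ct : (PBond (F.P K) 0 → Matrix (Fin 2) (Fin 2) ℂ) → (PBond (F.P n) 0 → Matrix (Fin 2) (Fin 2) ℂ))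
    {B₀ C₄ a₃ BH BH₂ C₂ R εb r ε₁ MΔ : ℝ} (hB₀ : 0 < B₀) (hC₄ : 0 < C₄) (hBH : 0 ≤ BH) (hBH₂ : 0 ≤ BH₂) (hC₂ : 0 ≤ C₂) (hε₁ : 0 < ε₁) (hMΔ : 0 ≤ MΔ)
    -- the displayed letter rows N06(d = 3) ∕ P4 ∕ (46)₀ ∕ (46)₁ ∕ (46)₂ = (137)–(140) for `H`
    (norm_G : ∀ f, ‖𝒢 f‖ ≤ B₀ * ‖f‖) (quad : QuadAnalytic W C₄ a₃) (norm_H₁ : ∀ b, ‖H₁ b‖ ≤ B₀ * ‖b‖)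
    (h46₀ : ∀ Y, ‖H Y‖ ≤ BH * eta F n K * ‖Y‖)
    (h46₁ : ∀ (Y : PBond (F.P n) 0 → Matrix (Fin 2) (Fin 2) ℂ) (μ ν : Fin (F.P K).d) (x : Site (F.P K) 0),
      ‖covGradT 1 (bgUnits F K U₀) (H Y) μ ν x‖ ≤ BH * eta F n K ^ 2 * ‖Y‖)
    (h46₂ : ∀ (Y : PBond (F.P n) 0 → Matrix (Fin 2) (Fin 2) ℂ),
      (∀ (μ : Fin (F.P K).d) (x : Site (F.P K) 0), ‖covCodiffCurlT 1 (bgUnits F K U₀) (H Y) μ x‖ ≤ BH₂ * eta F n K ^ 3 * ‖Y‖) ∧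
      (∀ (ν : Fin (F.P K).d) (x : Site (F.P K) 0), ‖covLapFormT 1 (bgUnits F K U₀) (H Y) ν x‖ ≤ BH₂ * eta F n K ^ 3 * ‖Y‖))
    -- the chart (47) as a quadratic-analytic map and the contraction windows of (55)
    (hC : QuadAnalytic Ct C₂ R) (hq : 9 * C₂ * (BH * eta F n K) * εb < 1) (hR : 3 * εb ≤ R)
    (hεb : eta F n K * (3 * B₀ * ((F.L : ℝ) ^ 3 * (3 * (F.L : ℝ)) * ε₁) + B₀ * (2 * ((3 : ℝ) * F.L) * ((F.L : ℝ) ^ 3 * ε₁))) ≤ εb)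
    -- Prop. 6's windows (`ε₄ := r`, `C₁ := L³`, `B₃ := 3L`)
    (h1 : 2 * B₀ * (F.L : ℝ) ^ 3 * (3 * (F.L : ℝ)) * ε₁ ≤ r) (h2 : 4 * r ≤ a₃) (h3 : 16 * B₀ * C₄ * r ≤ 1)
    -- `hSize19′`'s own guards
    (hreg : RegPr F n K ((F.L : ℝ) ^ 3 * (3 * (F.L : ℝ)) * ε₁) U₀) (hclose : CloseAvg F n K h ((F.L : ℝ) ^ 3 * ε₁) V U₀) (hwin : (F.L : ℝ) ^ 3 * ε₁ ≤ 1 / 2)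
    -- the displayed solution of (111)
    (A₁ : Space115 (F.L : ℝ) (((F.L : ℝ)⁻¹) ^ (K - n)) (fun _ : Bond 3 (periodsT3 F K) => K - n) (fun _ : Bond 3 (periodsT3 F K) × Fin 3 => K - n)
      (nabla115 (((F.L : ℝ)⁻¹) ^ (K - n)) (bgOfCfg F K U₀)))
    (hA₁ : ‖A₁‖ < r)
    (heq : A₁ + 𝒢 (Jcur (bgOfCfg F K U₀)) + 𝒢 (W (A₁ + H₁ (fun c : PBond (F.P n) 0 =>
          (-Complex.I) • mlog (((V c : Matrix.specialUnitaryGroup (Fin 2) ℂ) : Matrix (Fin 2) (Fin 2) ℂ)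
            * star ((descendTo F ℰp n K h U₀ c : Matrix.specialUnitaryGroup (Fin 2) ℂ) : Matrix (Fin 2) (Fin 2) ℂ))))) = 0)
    -- ROW `hΔsol` — (136) + (140) for the (115)-piece of the solution, print's ε₁-form, one power of `η` below the chart exponent
    (hΔsol : (∀ (μ : Fin (F.P K).d) (x : Site (F.P K) 0),
        ‖covCodiffCurlT 1 (bgUnits F K U₀) ((fun b : PBond (F.P K) 0 => JetSup.equiv _ _ _ A₁ (bondEquiv F K b))
            + (fun b : PBond (F.P K) 0 => JetSup.equiv _ _ _ (H₁ (fun c : PBond (F.P n) 0 =>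
          (-Complex.I) • mlog (((V c : Matrix.specialUnitaryGroup (Fin 2) ℂ) : Matrix (Fin 2) (Fin 2) ℂ)
            * star ((descendTo F ℰp n K h U₀ c : Matrix.specialUnitaryGroup (Fin 2) ℂ) : Matrix (Fin 2) (Fin 2) ℂ)))) (bondEquiv F K b))) μ x‖
          ≤ MΔ * ((F.L : ℝ) ^ 3 * (3 * (F.L : ℝ)) * ε₁) * eta F n K ^ 2) ∧
      (∀ (ν : Fin (F.P K).d) (x : Site (F.P K) 0),
        ‖covLapFormT 1 (bgUnits F K U₀) ((fun b : PBond (F.P K) 0 => JetSup.equiv _ _ _ A₁ (bondEquiv F K b))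
            + (fun b : PBond (F.P K) 0 => JetSup.equiv _ _ _ (H₁ (fun c : PBond (F.P n) 0 =>
          (-Complex.I) • mlog (((V c : Matrix.specialUnitaryGroup (Fin 2) ℂ) : Matrix (Fin 2) (Fin 2) ℂ)
            * star ((descendTo F ℰp n K h U₀ c : Matrix.specialUnitaryGroup (Fin 2) ℂ) : Matrix (Fin 2) (Fin 2) ℂ)))) (bondEquiv F K b))) ν x‖
          ≤ MΔ * ((F.L : ℝ) ^ 3 * (3 * (F.L : ℝ)) * ε₁) * eta F n K ^ 2)) :
    nMax19 F n K U₀ (fun b : PBond (F.P K) 0 =>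
          (-Complex.I) • ((((eta F n K : ℝ) : ℂ) * Complex.I) • ((fun b : PBond (F.P K) 0 => JetSup.equiv _ _ _ A₁ (bondEquiv F K b))
            + (fun b : PBond (F.P K) 0 => JetSup.equiv _ _ _ (H₁ (fun c : PBond (F.P n) 0 =>
          (-Complex.I) • mlog (((V c : Matrix.specialUnitaryGroup (Fin 2) ℂ) : Matrix (Fin 2) (Fin 2) ℂ)
            * star ((descendTo F ℰp n K h U₀ c : Matrix.specialUnitaryGroup (Fin 2) ℂ) : Matrix (Fin 2) (Fin 2) ℂ)))) (bondEquiv F K b)))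
          - H (Dfix Ct H C₂ ((((eta F n K : ℝ) : ℂ) * Complex.I) • ((fun b : PBond (F.P K) 0 => JetSup.equiv _ _ _ A₁ (bondEquiv F K b))
            + (fun b : PBond (F.P K) 0 => JetSup.equiv _ _ _ (H₁ (fun c : PBond (F.P n) 0 =>
          (-Complex.I) • mlog (((V c : Matrix.specialUnitaryGroup (Fin 2) ℂ) : Matrix (Fin 2) (Fin 2) ℂ)
            * star ((descendTo F ℰp n K h U₀ c : Matrix.specialUnitaryGroup (Fin 2) ℂ) : Matrix (Fin 2) (Fin 2) ℂ)))) (bondEquiv F K b)))))) b)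
      ≤ (11 * B₀ + 4 * BH * C₂ * eta F n K ^ 2 * (11 * B₀) ^ 2 * ((F.L : ℝ) ^ 3 * (3 * (F.L : ℝ)) * ε₁)
          + MΔ + 100 * BH₂ * C₂ * B₀ ^ 2 * eta F n K ^ 2 * ((F.L : ℝ) ^ 3 * (3 * (F.L : ℝ)) * ε₁)) * ((F.L : ℝ) ^ 3 * (3 * (F.L : ℝ)) * ε₁) := by
  have hL : 0 < (F.L : ℝ) := Fact.out
  have hη : 0 < eta F n K := eta_pos F n K
  have hρ : 0 < ((F.L : ℝ) ^ 3 * (3 * (F.L : ℝ)) * ε₁) := by positivity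
  -- orders 0, 1 (✓p654309)
  obtain ⟨h0, h1o⟩ := orders01_of_eq111_T3 F n K h U₀ V 𝒢 W H₁ H Ct hB₀ hC₄ hBH hC₂ hε₁ norm_G quad norm_H₁ h46₀ h46₁ hC hq hR hεb h1 h2 h3
    hreg hclose hwin A₁ hA₁ heq
  -- the datum `B̃` and the (115)-piece `Y := ιA₁ + ι(H₁B̃)`
  set Bt : PBond (F.P n) 0 → Matrix (Fin 2) (Fin 2) ℂ := fun c : PBond (F.P n) 0 =>
    (-Complex.I) • mlog (((V c : Matrix.specialUnitaryGroup (Fin 2) ℂ) : Matrix (Fin 2) (Fin 2) ℂ)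
      * star ((descendTo F ℰp n K h U₀ c : Matrix.specialUnitaryGroup (Fin 2) ℂ) : Matrix (Fin 2) (Fin 2) ℂ)) with hBtdef
  set Y : PBond (F.P K) 0 → Matrix (Fin 2) (Fin 2) ℂ := (fun b : PBond (F.P K) 0 => JetSup.equiv _ _ _ A₁ (bondEquiv F K b))
      + (fun b : PBond (F.P K) 0 => JetSup.equiv _ _ _ (H₁ Bt) (bondEquiv F K b)) with hYdef
  set A' : PBond (F.P K) 0 → Matrix (Fin 2) (Fin 2) ℂ := (((eta F n K : ℝ) : ℂ) * Complex.I) • Y with hA'def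
  set D := Dfix Ct H C₂ A' with hDdef
  -- Prop. 6 (116): the a-priori size of the displayed solution, `‖A₁‖ < 3B₀((F.L : ℝ) ^ 3 * (3 * (F.L : ℝ)) * ε₁)`; (103) + (20): `‖H₁B̃‖ ≤ B₀·2·3L·L³ε₁ = 2B₀((F.L : ℝ) ^ 3 * (3 * (F.L : ℝ)) * ε₁)`
  have hBt : ‖Bt‖ < 2 * ((3 : ℝ) * F.L) * ((F.L : ℝ) ^ 3 * ε₁) := bound20_symLog_of_closeAvg F h hε₁ hwin V U₀ hclose
  have h2ρ : 2 * ((3 : ℝ) * F.L) * ((F.L : ℝ) ^ 3 * ε₁) = 2 * ((F.L : ℝ) ^ 3 * (3 * (F.L : ℝ)) * ε₁) := by ring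
  have h𝔄 : ‖H₁ Bt‖ < 2 * ((3 : ℝ) * F.L) * B₀ * (F.L : ℝ) ^ 3 * ε₁ := by
    calc ‖H₁ Bt‖ ≤ B₀ * ‖Bt‖ := norm_H₁ Bt
      _ < B₀ * (2 * ((3 : ℝ) * F.L) * ((F.L : ℝ) ^ 3 * ε₁)) := mul_lt_mul_of_pos_left hBt hB₀
      _ = 2 * ((3 : ℝ) * F.L) * B₀ * (F.L : ℝ) ^ 3 * ε₁ := by ring
  have h𝔄' : ‖H₁ Bt‖ ≤ 2 * B₀ * ((F.L : ℝ) ^ 3 * (3 * (F.L : ℝ)) * ε₁) := by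
    calc ‖H₁ Bt‖ ≤ B₀ * ‖Bt‖ := norm_H₁ Bt
      _ ≤ B₀ * (2 * ((3 : ℝ) * F.L) * ((F.L : ℝ) ^ 3 * ε₁)) := mul_le_mul_of_nonneg_left hBt.le hB₀.le
      _ = 2 * B₀ * ((F.L : ℝ) ^ 3 * (3 * (F.L : ℝ)) * ε₁) := by rw [h2ρ]; ring
  obtain ⟨A, -, -, hAsize, huniq⟩ := prop6_bgOfCfg F K n U₀ (𝒢 := 𝒢) (W := W) norm_G quad hB₀ hC₄ (by positivity : (0 : ℝ) < (F.L : ℝ) ^ 3)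
    (by positivity : (0 : ℝ) < 3 * (F.L : ℝ)) hε₁ (le_refl _) h1 h2 h3 hreg (𝔄 := H₁ Bt) h𝔄
  have hA₁size : ‖A₁‖ < 3 * B₀ * ((F.L : ℝ) ^ 3 * (3 * (F.L : ℝ)) * ε₁) := by
    rw [huniq A₁ hA₁ heq]; calc ‖A‖ < 3 * B₀ * (F.L : ℝ) ^ 3 * (3 * (F.L : ℝ)) * ε₁ := hAsize
      _ = 3 * B₀ * ((F.L : ℝ) ^ 3 * (3 * (F.L : ℝ)) * ε₁) := by ring
  -- the size of `A′` and (55) for `D(A′)`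
  have hYsum : Y = fun b : PBond (F.P K) 0 => JetSup.equiv _ _ _ (A₁ + H₁ Bt) (bondEquiv F K b) := by rw [hYdef, iota_add]
  have hfs : ‖A₁ + H₁ Bt‖ ≤ 5 * B₀ * ((F.L : ℝ) ^ 3 * (3 * (F.L : ℝ)) * ε₁) := by
    calc ‖A₁ + H₁ Bt‖ ≤ ‖A₁‖ + ‖H₁ Bt‖ := norm_add_le _ _
      _ ≤ 3 * B₀ * ((F.L : ℝ) ^ 3 * (3 * (F.L : ℝ)) * ε₁) + 2 * B₀ * ((F.L : ℝ) ^ 3 * (3 * (F.L : ℝ)) * ε₁) := add_le_add hA₁size.le h𝔄'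
      _ = 5 * B₀ * ((F.L : ℝ) ^ 3 * (3 * (F.L : ℝ)) * ε₁) := by ring
  have hI : ‖(Complex.I : ℂ)‖ ≤ 1 := by rw [Complex.norm_I]
  obtain ⟨hA'0, -⟩ := orders01_of_eta_smul_iota F n K U₀ (A₁ + H₁ Bt) Complex.I hI
  have hA'le : ‖A'‖ ≤ (eta F n K) * (5 * B₀ * ((F.L : ℝ) ^ 3 * (3 * (F.L : ℝ)) * ε₁)) := by
    refine (pi_norm_le_iff_of_nonneg (by positivity)).mpr fun b => ?_
    rw [hA'def, hYsum]; exact (hA'0 b).trans (mul_le_mul_of_nonneg_left hfs hη.le)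
  have hA'norm : ‖A'‖ < εb := by
    have hfs' : ‖A₁ + H₁ Bt‖ < 5 * B₀ * ((F.L : ℝ) ^ 3 * (3 * (F.L : ℝ)) * ε₁) := by
      calc ‖A₁ + H₁ Bt‖ ≤ ‖A₁‖ + ‖H₁ Bt‖ := norm_add_le _ _
        _ < 3 * B₀ * ((F.L : ℝ) ^ 3 * (3 * (F.L : ℝ)) * ε₁) + 2 * B₀ * ((F.L : ℝ) ^ 3 * (3 * (F.L : ℝ)) * ε₁) := add_lt_add_of_lt_of_le hA₁size h𝔄'
        _ = 5 * B₀ * ((F.L : ℝ) ^ 3 * (3 * (F.L : ℝ)) * ε₁) := by ring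
    have h1' : ‖A'‖ ≤ (eta F n K) * ‖A₁ + H₁ Bt‖ := by
      refine (pi_norm_le_iff_of_nonneg (by positivity)).mpr fun b => ?_
      rw [hA'def, hYsum]; exact hA'0 b
    have h5 : (eta F n K) * (5 * B₀ * ((F.L : ℝ) ^ 3 * (3 * (F.L : ℝ)) * ε₁)) = (eta F n K) * (3 * B₀ * ((F.L : ℝ) ^ 3 * (3 * (F.L : ℝ)) * ε₁) + B₀ * (2 * ((3 : ℝ) * F.L) * ((F.L : ℝ) ^ 3 * ε₁))) := by rw [h2ρ]; ring
    calc ‖A'‖ ≤ (eta F n K) * ‖A₁ + H₁ Bt‖ := h1'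
      _ < (eta F n K) * (5 * B₀ * ((F.L : ℝ) ^ 3 * (3 * (F.L : ℝ)) * ε₁)) := mul_lt_mul_of_pos_left hfs' hη
      _ = (eta F n K) * (3 * B₀ * ((F.L : ℝ) ^ 3 * (3 * (F.L : ℝ)) * ε₁) + B₀ * (2 * ((3 : ℝ) * F.L) * ((F.L : ℝ) ^ 3 * ε₁))) := h5
      _ ≤ εb := hεb
  have hHop : ∀ Z, ‖H Z‖ ≤ BH * (eta F n K) * ‖Z‖ := h46₀
  have hD : ‖D‖ ≤ 4 * C₂ * ‖A'‖ ^ 2 := (Dfix_spec hC hC₂ (by positivity) hHop hq hR hA'norm).1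
  have hD' : ‖D‖ ≤ 4 * C₂ * ((eta F n K) * (5 * B₀ * ((F.L : ℝ) ^ 3 * (3 * (F.L : ℝ)) * ε₁))) ^ 2 :=
    hD.trans (mul_le_mul_of_nonneg_left (pow_le_pow_left₀ (norm_nonneg _) hA'le 2) (by positivity))
  -- order 2 of the two pieces
  obtain ⟨hHD2a, hHD2b⟩ := h46₂ D
  have hX : (fun b : PBond (F.P K) 0 => (-Complex.I) • (A' - H D) b) = (-Complex.I) • (A' - H D) := rfl
  have hnI : ‖(-Complex.I : ℂ)‖ = 1 := by rw [norm_neg, Complex.norm_I]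
  have hηI : ‖(((eta F n K : ℝ) : ℂ) * Complex.I)‖ = (eta F n K) := by
    rw [norm_mul, Complex.norm_real, Complex.norm_I, mul_one, Real.norm_of_nonneg hη.le]
  have hbound2 : (eta F n K) * (MΔ * ((F.L : ℝ) ^ 3 * (3 * (F.L : ℝ)) * ε₁) * (eta F n K) ^ 2) + BH₂ * (eta F n K) ^ 3 * (4 * C₂ * ((eta F n K) * (5 * B₀ * ((F.L : ℝ) ^ 3 * (3 * (F.L : ℝ)) * ε₁))) ^ 2)
      = (MΔ + 100 * BH₂ * C₂ * B₀ ^ 2 * (eta F n K) ^ 2 * ((F.L : ℝ) ^ 3 * (3 * (F.L : ℝ)) * ε₁)) * ((F.L : ℝ) ^ 3 * (3 * (F.L : ℝ)) * ε₁) * (eta F n K) ^ 3 := by ring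
  have hc2 : ∀ (μ : Fin (F.P K).d) (x : Site (F.P K) 0),
      ‖covCodiffCurlT 1 (bgUnits F K U₀) (fun b : PBond (F.P K) 0 => (-Complex.I) • (A' - H D) b) μ x‖
        ≤ (MΔ + 100 * BH₂ * C₂ * B₀ ^ 2 * (eta F n K) ^ 2 * ((F.L : ℝ) ^ 3 * (3 * (F.L : ℝ)) * ε₁)) * ((F.L : ℝ) ^ 3 * (3 * (F.L : ℝ)) * ε₁) * (eta F n K) ^ 3 := by
    intro μ x
    rw [hX, covCodiffCurlT_smul_complex, covCodiffCurlT_sub, norm_smul, hnI, one_mul, hA'def, covCodiffCurlT_smul_complex]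
    calc ‖(((eta F n K : ℝ) : ℂ) * Complex.I) • covCodiffCurlT 1 (bgUnits F K U₀) Y μ x - covCodiffCurlT 1 (bgUnits F K U₀) (H D) μ x‖
        ≤ ‖(((eta F n K : ℝ) : ℂ) * Complex.I) • covCodiffCurlT 1 (bgUnits F K U₀) Y μ x‖ + ‖covCodiffCurlT 1 (bgUnits F K U₀) (H D) μ x‖ := norm_sub_le _ _
      _ ≤ (eta F n K) * (MΔ * ((F.L : ℝ) ^ 3 * (3 * (F.L : ℝ)) * ε₁) * (eta F n K) ^ 2) + BH₂ * (eta F n K) ^ 3 * (4 * C₂ * ((eta F n K) * (5 * B₀ * ((F.L : ℝ) ^ 3 * (3 * (F.L : ℝ)) * ε₁))) ^ 2) := by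
          refine add_le_add ?_ ((hHD2a μ x).trans (mul_le_mul_of_nonneg_left hD' (by positivity)))
          rw [norm_smul, hηI]; exact mul_le_mul_of_nonneg_left (hΔsol.1 μ x) hη.le
      _ = (MΔ + 100 * BH₂ * C₂ * B₀ ^ 2 * (eta F n K) ^ 2 * ((F.L : ℝ) ^ 3 * (3 * (F.L : ℝ)) * ε₁)) * ((F.L : ℝ) ^ 3 * (3 * (F.L : ℝ)) * ε₁) * (eta F n K) ^ 3 := hbound2
  have hl2 : ∀ (ν : Fin (F.P K).d) (x : Site (F.P K) 0),
      ‖covLapFormT 1 (bgUnits F K U₀) (fun b : PBond (F.P K) 0 => (-Complex.I) • (A' - H D) b) ν x‖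
        ≤ (MΔ + 100 * BH₂ * C₂ * B₀ ^ 2 * (eta F n K) ^ 2 * ((F.L : ℝ) ^ 3 * (3 * (F.L : ℝ)) * ε₁)) * ((F.L : ℝ) ^ 3 * (3 * (F.L : ℝ)) * ε₁) * (eta F n K) ^ 3 := by
    intro ν x
    rw [hX, covLapFormT_smul_complex, covLapFormT_sub, norm_smul, hnI, one_mul, hA'def, covLapFormT_smul_complex]
    calc ‖(((eta F n K : ℝ) : ℂ) * Complex.I) • covLapFormT 1 (bgUnits F K U₀) Y ν x - covLapFormT 1 (bgUnits F K U₀) (H D) ν x‖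
        ≤ ‖(((eta F n K : ℝ) : ℂ) * Complex.I) • covLapFormT 1 (bgUnits F K U₀) Y ν x‖ + ‖covLapFormT 1 (bgUnits F K U₀) (H D) ν x‖ := norm_sub_le _ _
      _ ≤ (eta F n K) * (MΔ * ((F.L : ℝ) ^ 3 * (3 * (F.L : ℝ)) * ε₁) * (eta F n K) ^ 2) + BH₂ * (eta F n K) ^ 3 * (4 * C₂ * ((eta F n K) * (5 * B₀ * ((F.L : ℝ) ^ 3 * (3 * (F.L : ℝ)) * ε₁))) ^ 2) := by
          refine add_le_add ?_ ((hHD2b ν x).trans (mul_le_mul_of_nonneg_left hD' (by positivity)))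
          rw [norm_smul, hηI]; exact mul_le_mul_of_nonneg_left (hΔsol.2 ν x) hη.le
      _ = (MΔ + 100 * BH₂ * C₂ * B₀ ^ 2 * (eta F n K) ^ 2 * ((F.L : ℝ) ^ 3 * (3 * (F.L : ℝ)) * ε₁)) * ((F.L : ℝ) ^ 3 * (3 * (F.L : ℝ)) * ε₁) * (eta F n K) ^ 3 := hbound2
  -- collect the four members under ONE constant
  have hρ0 : 0 ≤ ((F.L : ℝ) ^ 3 * (3 * (F.L : ℝ)) * ε₁) := hρ.le
  have hP : 0 ≤ 100 * BH₂ * C₂ * B₀ ^ 2 * eta F n K ^ 2 * ((F.L : ℝ) ^ 3 * (3 * (F.L : ℝ)) * ε₁) := by positivity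
  have hQ : 0 ≤ 4 * BH * C₂ * eta F n K ^ 2 * (11 * B₀) ^ 2 * ((F.L : ℝ) ^ 3 * (3 * (F.L : ℝ)) * ε₁) := by positivity
  have hsum1 : 11 * B₀ + 4 * BH * C₂ * eta F n K ^ 2 * (11 * B₀) ^ 2 * ((F.L : ℝ) ^ 3 * (3 * (F.L : ℝ)) * ε₁)
      ≤ 11 * B₀ + 4 * BH * C₂ * eta F n K ^ 2 * (11 * B₀) ^ 2 * ((F.L : ℝ) ^ 3 * (3 * (F.L : ℝ)) * ε₁) + MΔ + 100 * BH₂ * C₂ * B₀ ^ 2 * eta F n K ^ 2 * ((F.L : ℝ) ^ 3 * (3 * (F.L : ℝ)) * ε₁) := by linarith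
  have hsum2 : MΔ + 100 * BH₂ * C₂ * B₀ ^ 2 * eta F n K ^ 2 * ((F.L : ℝ) ^ 3 * (3 * (F.L : ℝ)) * ε₁)
      ≤ 11 * B₀ + 4 * BH * C₂ * eta F n K ^ 2 * (11 * B₀) ^ 2 * ((F.L : ℝ) ^ 3 * (3 * (F.L : ℝ)) * ε₁) + MΔ + 100 * BH₂ * C₂ * B₀ ^ 2 * eta F n K ^ 2 * ((F.L : ℝ) ^ 3 * (3 * (F.L : ℝ)) * ε₁) := by
    have : 0 ≤ 11 * B₀ := by positivity
    linarith
  refine nMax19_le_iff.mpr ⟨fun b => (h0 b).trans ?_, fun μ ν x => (h1o μ ν x).trans ?_, fun μ x => (hc2 μ x).trans ?_, fun ν x => (hl2 ν x).trans ?_⟩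
  · exact mul_le_mul_of_nonneg_right (mul_le_mul_of_nonneg_right hsum1 hρ0) hη.le
  · exact mul_le_mul_of_nonneg_right (mul_le_mul_of_nonneg_right hsum1 hρ0) (by positivity)
  · exact mul_le_mul_of_nonneg_right (mul_le_mul_of_nonneg_right hsum2 hρ0) (by positivity)
  · exact mul_le_mul_of_nonneg_right (mul_le_mul_of_nonneg_right hsum2 hρ0) (by positivity)

end Summit.QuantumFields.YangMills.Theorems.Prop7Size19OfRows

end
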